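/-
Copyright: b2b-lace packet (CARVER gen 56).  [FvdH17] §5.1 "Elements of the bounds" / App. B Table "definition of
`P^{ι,b}(x,y)`" row `b = 1`: the ENTRY INEQUALITY for the element `(P⃗^ι)_1` over the tree objects `vecPiota`, `vecPS`
(`NobleWeightedBlocks`), its landed closed form `NobleBlocks.vecPiota_one` (`NobleElementsClosedFormsRows`),
`Letters.perc` (`NoblePercLetters`), `tauGe` (`NobleBoundsN0`), the exact-leg peel `perc_B_eqOne₂_le_p_mul_tau`
(`NoblePeelExactLeg`) and the signed-permutation classes of `τ_p` (`NobleBoundsN0LowerOrbit`).  Option (A) of REFEREE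
R1316/R1322 for the notebook cell 545: the `x = e_ι` row is typed VERBATIM (no sharpening).  Proofs only; no named
fact; no numeral; no dimension.
-/
import Literature.Probability.FitznerVanDerHofstad2017.NoblePeelExactLeg
import Literature.Probability.FitznerVanDerHofstad2017.NobleElementsClosedFormsRows
import Literature.Probability.FitznerVanDerHofstad2017.NobleBoundsN0LowerOrbit
import Literature.Probability.FitznerVanDerHofstad2017.NonRepulsiveDiagramBounds
import HarnessLib

/-!
# [FvdH17] §5.1: the entry `(P⃗^ι)_1 ≤ τ̄₃·(P⃗^S)_1 + p·(τ̄(2e₁) + (2d−2)·τ̄(e₁+e₂))`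

CITATION HEADER (PLACEMENT v2). This module is part of a certified REPRODUCTION of:
R. Fitzner, R. van der Hofstad, *Mean-field behavior for nearest-neighbor percolation in `d > 10`*,
Electron. J. Probab. **22** (2017) no. 43 [FvdH17] (extended version arXiv:1506.07977v2), §5.1 "Elements of the
bounds" (arXiv v2 p. 50: `(P⃗^ι)_b = (1/2d)[δ_{0,b} + Σ_{ι,x,y} P^{ι,b}(x,y)]`), App. B Table "Diagrams and definition
of `P^{ι,b}(x,y)`" row `b = 1` (v2 p. 73: "y on sausage" `τ_{3,p}(e_ι)(δ_{e_ι,y}𝓑_{3,1̲}(x−e_ι,0) + 𝓣_{1,1̲,1}(y−e_ι,x−e_ι,0))`,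
"x = e_ι" `𝓑_{2,1̲}(y,e_ι)`), §6.1 proof of Lemma 5.2, Case `a = 1` (v2 p. 60: `δ_{u,e_ι}𝓑_{2,1̲}(w,e_ι) + …`), §4.2 (4.1), (4.10), (4.16)
(pp. 34–36: `τ_{n,p}`, the pivotal-bond peel of an exact-length line, the repulsive bubble); and of
R. Fitzner, R. van der Hofstad, *Generalized approach to the non-backtracking lace expansion*, Probab. Theory Related
Fields **169** (2017) 1041–1119 [NoBLE17], Def. 2.5 p. 1058 (total rotational symmetry of the two-point function).
Origin: build `lace` (host summit CriticalPhenomena), CARVER seat; node N76-PIOTA1 of the cell's lemma DAG (leaf L4 of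
the REV15 precondition census: the `P⃗^ι` entry producers consumed by the `ι`-families `Ξ^ι`), OPTION (A) of the
cell's REFEREE rulings R1316 (3) / R1322 (2): the row `x = e_ι` is the printed per-`(u,w)` object `Σ_y 𝓑_{2,1̲}(y,e_ι)`
typed verbatim and bounded letter by letter; the authors' notebook (`Percolation.nb`, the `P^ι` cell:
`Bound[Piota,1,s] = Bound[G,{1},3,s]·(1 + Bound[PS,1,s])`) prices that row by `τ̄₃`, a sharper value the printed
inequalities do not give as read (cell DIVERGENCE rows D91/D92 of the packet); this module does NOT use it.

WHAT THIS FILE DOES.  `NobleBlocks.vecPiota_one` is the identity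
`(P⃗^ι)_1 = (1/2d) Σ_ι [τ_{(≥3)}(e_ι)·((Σ_x 𝓑_{≥3,1̲}(x,0)) + Σ_{x,y} 𝓣_{≥1,1̲,≥1}(y,x,0)) + Σ_y 𝓑_{≥2,1̲}(y,e_ι)]`
for every letter table.  At `L = Letters.perc d p`: (i) the bracket equals `(P⃗^S)_1 = vecPS L 1`
(`NobleBlocks.vecPS_one`: the two truncations `x ≠ 0`, `y ≠ 0` of the sausage row are free, because `𝓑_{j,1̲}(0,0) = 0`
— `0` is not a unit vector, `perc_B_eqOne₂_eq_zero` — and `𝓣_{≥1,j₂,j₃}(0,·,·) ≤ τ_{(≥1)}(0)·… = 0`,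
`𝓣_{j₁,j₂,≥1}(x,0,0) ≤ …·τ_{(≥1)}(0) = 0`, `perc_T_le_Tst`, `tauGe_zero_of_ne`), so ANY majorant `(P⃗^S)_1 ≤ W` —
the binder the `P⃗^S`-entry producers already discharge — bounds it; (ii) `τ_{(≥3)}(e_ι) = ofReal τ_{3,p}(e₁) ≤ ofReal T3`
(`perc_tau_ge`, `tauGe_stepVec`); (iii) the `x = e_ι` row: `𝓑_{≥2,1̲}(y,e_ι)` vanishes unless `e_ι − y` is a unit vector
and is `≤ p·τ_{(≥2)}(y)` (`perc_B_eqOne₂_le_p_mul_tau`), so `Σ_y 𝓑_{≥2,1̲}(y,e_ι) ≤ p·Σ_κ τ_{(≥2)}(e_ι − e_κ)`; the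
direction `κ = ι` contributes `τ_{(≥2)}(0) = 0`, `κ = −ι` contributes `τ_{(≥2)}(2e_ι) ≤ τ_p(2e_a)` and the `2d − 2`
directions with `κ.1 ≠ ι.1` contribute `τ_{(≥2)}(e_ι − e_κ) ≤ τ_p(e_a + e_b)` (`tauGe_le_tau` and the signed-permutation
classes `tau_stepVec_two`, `tau_stepVec_add_stepVec`), whence `≤ p·(T2 + (2d − 2)·T11)` for any `τ_p(2e_a) ≤ T2`,
`τ_p(e_a + e_b) ≤ T11` (`a ≠ b`) — the two-point letters already read by the packet's `N = 0` kernels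
(`FvdH17ext_L53_piAlpha_lower_of_tau_le`).  The factor `1/2d` cancels the direction sum.  Results:

* `perc_B_ge_eqOne_zero_eq_kdc_mul`, `perc_T_geOne_eq_kdc_mul`, `perc_T_ge_ge_geOne_zero_eq_kdc_mul` — the free
  truncations at the percolation letters;
* `perc_sausageRow_one_eq_vecPS` — `(Σ_x 𝓑_{≥3,1̲}(x,0)) + Σ_{x,y} 𝓣_{≥1,1̲,≥1}(y,x,0) = vecPS (Letters.perc d p) 1`;
* `perc_tsum_B_ge_eqOne_stepVec_le_sum` — `Σ_y 𝓑_{≥m,1̲}(y,e_ι) ≤ ofReal p · Σ_κ τ_{(≥m)}(e_ι − e_κ)`;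
* `perc_sum_tau_geTwo_stepVec_sub_le` — `Σ_κ τ_{(≥2)}(e_ι − e_κ) ≤ ofReal T2 + (2d − 2)·ofReal T11`;
* `perc_tsum_B_geTwo_eqOne_stepVec_le_ofReal` — `Σ_y 𝓑_{≥2,1̲}(y,e_ι) ≤ ofReal (p·(T2 + (2d − 2)·T11))`;
* `perc_vecPiota_one_le` — **the entry inequality, `ℝ≥0∞` shape**:
  `vecPiota (Letters.perc d p) 1 ≤ ofReal T3 · W + ofReal (p·(T2 + (2d − 2)·T11))` for `2 ≤ d`;
* `perc_vecPiota_one_le_ofReal` — the same as ONE `ENNReal.ofReal (T3·W₁ + p·(T2 + (2d − 2)·T11))` for a real majorant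
  `W₁ ≥ 0` of `(P⃗^S)_1` (the shape consumed by the block-summation majorant; `0 ≤ T2`, `0 ≤ T11` follow from
  `τ_p ≥ 0`).

`T3`, `W`/`W₁`, `T2`, `T11` stay binders with landed producers (`TwoPointSrwBound.tauGe_le_trailExtraction_srw`, the
`vecPS`-one producers `NoblePeelEntryOne.perc_vecPS_one_le_ofReal_of_vecPE` / `NobleExactLegSlots.perc_vecPE_one_le_xslot`,
the packet's two-point letters).  Any `d ≥ 2`; no `p < p_c` is needed; nothing landed is modified; no cited hypothesis —
every statement is a kernel-proved inequality between landed definitions.  The identification of the bound expression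
with the engines' what-if row (`Bound[Piota,1,s] = G3·PS1 + z[s]·(Bound[G,{0,1},2,s] + ((2d)−2)·Bound[G,{2},2,s])`)
and every numerical reading are NOT part of this module.
-/

noncomputable section

namespace Literature.Probability.FitznerVanDerHofstad2017

open MeasureTheory Finset
open scoped BigOperators ENNReal
open Literature.Probability.LatticeModels Literature.Probability.Percolation
open Literature.Barriers.CriticalPhenomena
open Literature.Probability.FitznerVanDerHofstad2017.NobleBlocks

variable {d : ℕ}

/-! ## A. The free truncations of the sausage row at the percolation letters -/

/-- `0` is not a unit vector. [folklore] -/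
private theorem zero_not_mem_unitVecs : (0 : Site d) ∉ unitVecs d := fun h => by
  obtain ⟨ι, hι⟩ := mem_unitVecs_iff.1 h
  have h1 := congr_fun hι ι.1
  simp only [Pi.zero_apply, stepVec] at h1
  split_ifs at h1 <;> simp at h1

/-- `𝓑_{≥m,1̲}(x,0) = (1−δ_{x,0})·𝓑_{≥m,1̲}(x,0)`: the `x = 0` term vanishes (`0 − 0 = 0` is not a unit vector, so the
exact one-bond line of the bubble is impossible).
[cite: FitznerVanDerHofstad2017, §4.2 (4.16) (arXiv:1506.07977v2 p. 36); App. B Table "definition of P^b(x,y)" row b = 1 (p. 73)] -/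
theorem perc_B_ge_eqOne_zero_eq_kdc_mul (p : unitInterval) (m : ℕ) (x : Site d) :
    (Letters.perc d p).B (.ge m) (.eq 1) x 0 = kdc x 0 * (Letters.perc d p).B (.ge m) (.eq 1) x 0 := by
  by_cases hx : x = 0
  · subst hx
    rw [perc_B_eqOne₂_eq_zero p (.ge m) (by rw [sub_zero]; exact zero_not_mem_unitVecs), mul_zero]
  · rw [kdc_of_ne hx, one_mul]

/-- `𝓣_{≥1,j₂,j₃}(v,y,x) = (1−δ_{v,0})·𝓣_{≥1,j₂,j₃}(v,y,x)`: the `v = 0` term vanishes (`𝓣 ≤ 𝓣* = τ_{(≥1)}(0)·… = 0`,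
`τ_{1,p}(0) = 0`). [cite: FitznerVanDerHofstad2017, §4.2 (4.1), (4.8), (4.14)–(4.17) (arXiv:1506.07977v2 pp. 34–36)] -/
theorem perc_T_geOne_eq_kdc_mul (p : unitInterval) (j₂ j₃ : LenIdx) (v y x : Site d) :
    (Letters.perc d p).T (.ge 1) j₂ j₃ v y x = kdc v 0 * (Letters.perc d p).T (.ge 1) j₂ j₃ v y x := by
  by_cases hv : v = 0
  · subst hv
    have h0 : (Letters.perc d p).T (.ge 1) j₂ j₃ 0 y x = 0 := by
      refine le_antisymm ((perc_T_le_Tst p (.ge 1) j₂ j₃ 0 y x).trans ?_) bot_le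
      rw [Letters.Tst, Letters.Bst, perc_tau_ge, tauGe_zero_of_ne p one_ne_zero, ENNReal.ofReal_zero, zero_mul,
        zero_mul]
    rw [h0, mul_zero]
  · rw [kdc_of_ne hv, one_mul]

/-- `𝓣_{j₁,j₂,≥1}(v,y,0) = (1−δ_{y,0})·𝓣_{j₁,j₂,≥1}(v,y,0)`: for the endpoint `0` the `y = 0` term vanishes
(`𝓣 ≤ 𝓣* = …·τ_{(≥1)}(0 − 0) = 0`). [cite: FitznerVanDerHofstad2017, §4.2 (4.1), (4.8), (4.14)–(4.17) (arXiv:1506.07977v2 pp. 34–36)] -/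
theorem perc_T_ge_ge_geOne_zero_eq_kdc_mul (p : unitInterval) (j₁ j₂ : LenIdx) (v y : Site d) :
    (Letters.perc d p).T j₁ j₂ (.ge 1) v y 0 = kdc y 0 * (Letters.perc d p).T j₁ j₂ (.ge 1) v y 0 := by
  by_cases hy : y = 0
  · subst hy
    have h0 : (Letters.perc d p).T j₁ j₂ (.ge 1) v 0 0 = 0 := by
      refine le_antisymm ((perc_T_le_Tst p j₁ j₂ (.ge 1) v 0 0).trans ?_) bot_le
      rw [Letters.Tst, sub_zero, perc_tau_ge, tauGe_zero_of_ne p one_ne_zero, ENNReal.ofReal_zero, mul_zero]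
    rw [h0, mul_zero]
  · rw [kdc_of_ne hy, one_mul]

/-- **The summed sausage row of `P^{ι,1}` is `(P⃗^S)_1`** at the percolation letters:
`(Σ_x 𝓑_{≥3,1̲}(x,0)) + Σ_x Σ_y 𝓣_{≥1,1̲,≥1}(y,x,0) = vecPS (Letters.perc d p) 1` (`vecPS_one` carries the truncations
`x ≠ 0`, `y ≠ 0` of the Table, which are free here).
[cite: FitznerVanDerHofstad2017, App. B Table "definition of P^{ι,b}(x,y)" row b = 1 and Table "definition of P^b(x,y)" row b = 1 (arXiv:1506.07977v2 p. 73); §5.1 "Elements of the bounds" (pp. 49–50)] -/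
theorem perc_sausageRow_one_eq_vecPS (p : unitInterval) :
    (∑' x, (Letters.perc d p).B (.ge 3) (.eq 1) x 0) +
        ∑' x, ∑' y, (Letters.perc d p).T (.ge 1) (.eq 1) (.ge 1) y x 0 =
      vecPS (Letters.perc d p) 1 := by
  have hcomm : ∑' x, ∑' y, (Letters.perc d p).T (.ge 1) (.eq 1) (.ge 1) y x 0 =
      ∑' y, ∑' x, (Letters.perc d p).T (.ge 1) (.eq 1) (.ge 1) y x 0 := ENNReal.tsum_comm
  rw [vecPS_one, hcomm, ← ENNReal.tsum_add]
  refine tsum_congr fun v => ?_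
  rw [mul_add, ← perc_B_ge_eqOne_zero_eq_kdc_mul, ← ENNReal.tsum_mul_left]
  congr 1
  refine tsum_congr fun y => ?_
  rw [← perc_T_ge_ge_geOne_zero_eq_kdc_mul, ← perc_T_geOne_eq_kdc_mul]

/-! ## B. The `x = e_ι` row `Σ_y 𝓑_{≥m,1̲}(y,e_ι)` in the two-point letters -/

/-- **`Σ_y 𝓑_{≥m,1̲}(y,e_ι) ≤ p · Σ_κ τ_{(≥m)}(e_ι − e_κ)`**: the bubble vanishes unless `e_ι − y` is a unit vector
`e_κ` (its second line is the exact bond `{y ←1̲→ e_ι}`), and on the support the pivotal-bond peel gives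
`𝓑_{≥m,1̲}(y,e_ι) ≤ p·τ_{(≥m)}(y)`.
[cite: FitznerVanDerHofstad2017, §4.2 (4.10), (4.16) (arXiv:1506.07977v2 pp. 35–36); §6.1 proof of Lemma 5.2, Case a = 1 (p. 60); App. B Table "definition of P^{ι,b}(x,y)" row b = 1, x = e_ι (p. 73)] -/
theorem perc_tsum_B_ge_eqOne_stepVec_le_sum (p : unitInterval) (m : ℕ) (ι : Fin d × Bool) :
    ∑' y, (Letters.perc d p).B (.ge m) (.eq 1) y (stepVec ι) ≤
      ENNReal.ofReal p * ∑ κ : Fin d × Bool, (Letters.perc d p).tau (.ge m) (stepVec ι - stepVec κ) := by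
  classical
  have hre : ∑' y, (Letters.perc d p).B (.ge m) (.eq 1) y (stepVec ι) =
      ∑' z, (Letters.perc d p).B (.ge m) (.eq 1) (stepVec ι - z) (stepVec ι) :=
    ((Equiv.subLeft (stepVec ι : Site d)).tsum_eq
      fun y => (Letters.perc d p).B (.ge m) (.eq 1) y (stepVec ι)).symm
  rw [hre]
  calc ∑' z, (Letters.perc d p).B (.ge m) (.eq 1) (stepVec ι - z) (stepVec ι)
      = ∑ z ∈ unitVecs d, (Letters.perc d p).B (.ge m) (.eq 1) (stepVec ι - z) (stepVec ι) := by
        refine tsum_eq_sum fun z hz => ?_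
        exact perc_B_eqOne₂_eq_zero p (.ge m) (by rwa [sub_sub_cancel])
    _ ≤ ∑ z ∈ unitVecs d, ENNReal.ofReal p * (Letters.perc d p).tau (.ge m) (stepVec ι - z) :=
        Finset.sum_le_sum fun z _ => perc_B_eqOne₂_le_p_mul_tau p (.ge m) (stepVec ι - z) (stepVec ι)
    _ = ENNReal.ofReal p * ∑ κ : Fin d × Bool, (Letters.perc d p).tau (.ge m) (stepVec ι - stepVec κ) := by
        rw [← Finset.mul_sum, sum_unitVecs]

/-- Directions on the axis of `ι` are `ι` and `−ι`. [folklore] -/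
private theorem eq_or_eq_srev_of_fst_eq {ι κ : Fin d × Bool} (h : κ.1 = ι.1) : κ = ι ∨ κ = srev ι := by
  obtain ⟨a, s⟩ := ι
  obtain ⟨b, t⟩ := κ
  simp only at h
  subst h
  cases s <;> cases t <;> simp [srev]

/-- A direction sum whose `ι` term vanishes, whose `−ι` term is `≤ A` and whose `2d − 2` off-axis terms are `≤ B`
is `≤ A + (2d − 2)·B`. [folklore] -/
private theorem sum_dirs_le_of_axis {f : Fin d × Bool → ℝ≥0∞} (ι : Fin d × Bool) {A B : ℝ≥0∞} (h0 : f ι = 0)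
    (h1 : f (srev ι) ≤ A) (h2 : ∀ κ : Fin d × Bool, κ.1 ≠ ι.1 → f κ ≤ B) :
    ∑ κ, f κ ≤ A + ((2 * d - 2 : ℕ) : ℝ≥0∞) * B := by
  classical
  have hmem : srev ι ∈ (Finset.univ.erase ι : Finset (Fin d × Bool)) :=
    Finset.mem_erase.2 ⟨srev_ne_self ι, Finset.mem_univ _⟩
  have hcard : ((Finset.univ.erase ι).erase (srev ι) : Finset (Fin d × Bool)).card = 2 * d - 2 := by
    rw [Finset.card_erase_of_mem hmem, Finset.card_erase_of_mem (Finset.mem_univ ι), Finset.card_univ,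
      Fintype.card_prod, Fintype.card_fin, Fintype.card_bool]
    omega
  have h2' : ∀ κ ∈ (Finset.univ.erase ι).erase (srev ι), f κ ≤ B := by
    intro κ hκ
    simp only [Finset.mem_erase, Finset.mem_univ, and_true] at hκ
    refine h2 κ fun h => ?_
    rcases eq_or_eq_srev_of_fst_eq h with h' | h'
    · exact hκ.2 h'
    · exact hκ.1 h'
  rw [← Finset.add_sum_erase _ _ (Finset.mem_univ ι), ← Finset.add_sum_erase _ _ hmem, h0, zero_add]
  calc f (srev ι) + ∑ κ ∈ (Finset.univ.erase ι).erase (srev ι), f κ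
      ≤ A + ∑ _κ ∈ (Finset.univ.erase ι).erase (srev ι), B := add_le_add h1 (Finset.sum_le_sum h2')
    _ = A + ((2 * d - 2 : ℕ) : ℝ≥0∞) * B := by rw [Finset.sum_const, hcard, nsmul_eq_mul]

/-- **`Σ_κ τ_{(≥2)}(e_ι − e_κ) ≤ T2 + (2d − 2)·T11`** for `τ_p(2e_a) ≤ T2`, `τ_p(e_a + e_b) ≤ T11` (`a ≠ b`): the
direction `κ = ι` gives `τ_{(≥2)}(0) = 0`, `κ = −ι` the class `2e₁`, the other `2d − 2` directions the class `e₁ + e₂`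
(`τ_{(≥2)} ≤ τ_p` and the signed-permutation invariance of `τ_p`).
[cite: FitznerVanDerHofstad2017, §4.2 (4.1) (arXiv:1506.07977v2 p. 34); §6.1 proof of Lemma 5.2, Case a = 1 (p. 60)]
[cite: FitznerVanDerHofstad2016NoBLE, Def. 2.5 (PTRF 169 (2017) p. 1058)] -/
theorem perc_sum_tau_geTwo_stepVec_sub_le (p : unitInterval) (ι : Fin d × Bool) {a b : Fin d} (hab : a ≠ b)
    {T2 T11 : ℝ} (h2 : tau d p 0 (Pi.single a 2) ≤ T2) (h11 : tau d p 0 (Pi.single a 1 + Pi.single b 1) ≤ T11) :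
    ∑ κ : Fin d × Bool, (Letters.perc d p).tau (.ge 2) (stepVec ι - stepVec κ) ≤
      ENNReal.ofReal T2 + ((2 * d - 2 : ℕ) : ℝ≥0∞) * ENNReal.ofReal T11 := by
  refine sum_dirs_le_of_axis (f := fun κ => (Letters.perc d p).tau (.ge 2) (stepVec ι - stepVec κ)) ι ?_ ?_ ?_
  · simp only [sub_self, perc_tau_ge, tauGe_zero_of_ne p two_ne_zero, ENNReal.ofReal_zero]
  · simp only [stepVec_srev, sub_neg_eq_add, perc_tau_ge]
    exact ENNReal.ofReal_le_ofReal (((tauGe_le_tau p 2 _).trans_eq (tau_stepVec_two p ι a)).trans h2)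
  · intro κ hκ
    have hικ : ι.1 ≠ (srev κ).1 := fun h => hκ h.symm
    simp only [perc_tau_ge]
    refine ENNReal.ofReal_le_ofReal (((tauGe_le_tau p 2 _).trans_eq ?_).trans h11)
    rw [sub_eq_add_neg, ← stepVec_srev]
    exact tau_stepVec_add_stepVec p hικ hab

/-- **The `x = e_ι` row of `P^{ι,1}` in the two-point letters: `Σ_y 𝓑_{≥2,1̲}(y,e_ι) ≤ p·(T2 + (2d − 2)·T11)`** for
`τ_p(2e_a) ≤ T2`, `τ_p(e_a + e_b) ≤ T11` (`a ≠ b`).  This is the printed per-`(u,w)` object of §6.1 Case `a = 1` typed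
verbatim and bounded letter by letter — NOT the notebook's sharper `τ̄₃` (REFEREE R1322 (2), option (A)).
[cite: FitznerVanDerHofstad2017, §6.1 proof of Lemma 5.2, Case a = 1 (arXiv:1506.07977v2 p. 60); App. B Table "definition of P^{ι,b}(x,y)" row b = 1, x = e_ι (p. 73); §4.2 (4.1), (4.10), (4.16) (pp. 34–36)]
[cite: FitznerVanDerHofstad2016NoBLE, Def. 2.5 (PTRF 169 (2017) p. 1058)] -/
theorem perc_tsum_B_geTwo_eqOne_stepVec_le_ofReal (p : unitInterval) (ι : Fin d × Bool) {a b : Fin d}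
    (hab : a ≠ b) {T2 T11 : ℝ} (h2 : tau d p 0 (Pi.single a 2) ≤ T2)
    (h11 : tau d p 0 (Pi.single a 1 + Pi.single b 1) ≤ T11) :
    ∑' y, (Letters.perc d p).B (.ge 2) (.eq 1) y (stepVec ι) ≤
      ENNReal.ofReal ((p : ℝ) * (T2 + ((2 * d - 2 : ℕ) : ℝ) * T11)) := by
  have hT2 : 0 ≤ T2 := (Percolation.tau_nonneg p 0 _).trans h2
  have hT11 : 0 ≤ T11 := (Percolation.tau_nonneg p 0 _).trans h11
  refine (perc_tsum_B_ge_eqOne_stepVec_le_sum p 2 ι).trans ?_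
  refine (mul_le_mul' le_rfl (perc_sum_tau_geTwo_stepVec_sub_le p ι hab h2 h11)).trans_eq ?_
  rw [ENNReal.ofReal_mul p.2.1, ENNReal.ofReal_add hT2 (mul_nonneg (Nat.cast_nonneg _) hT11),
    ENNReal.ofReal_mul (Nat.cast_nonneg _), ENNReal.ofReal_natCast]

/-! ## C. The entry inequality for `(P⃗^ι)_1` -/

/-- **`(P⃗^ι)_1 ≤ τ̄₃·W + p·(T2 + (2d − 2)·T11)`, `ℝ≥0∞` shape** at the percolation letters: `τ_{3,p}(e₁) ≤ T3`,
`(P⃗^S)_1 ≤ W`, `τ_p(2e_a) ≤ T2`, `τ_p(e_a + e_b) ≤ T11` (`a ≠ b`, `d ≥ 2`).  The summed sausage row is `(P⃗^S)_1`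
itself (`perc_sausageRow_one_eq_vecPS`); the `x = e_ι` row is typed verbatim (option (A)); `1/2d` cancels the
direction sum.
[cite: FitznerVanDerHofstad2017, §5.1 "Elements of the bounds", `P⃗^ι` (arXiv:1506.07977v2 p. 50); App. B Table "definition of P^{ι,b}(x,y)" row b = 1 (p. 73); §6.1 proof of Lemma 5.2, Case a = 1 (p. 60)]
[cite: FitznerVanDerHofstad2016NoBLE, Def. 2.5 (PTRF 169 (2017) p. 1058)] -/
theorem perc_vecPiota_one_le (hd : 2 ≤ d) (p : unitInterval) {T3 : ℝ} (h3 : tauGe d p 3 (unitSite1 d) ≤ T3)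
    {W : ℝ≥0∞} (hW : vecPS (Letters.perc d p) 1 ≤ W) {a b : Fin d} (hab : a ≠ b) {T2 T11 : ℝ}
    (h2 : tau d p 0 (Pi.single a 2) ≤ T2) (h11 : tau d p 0 (Pi.single a 1 + Pi.single b 1) ≤ T11) :
    vecPiota (Letters.perc d p) 1 ≤
      ENNReal.ofReal T3 * W + ENNReal.ofReal ((p : ℝ) * (T2 + ((2 * d - 2 : ℕ) : ℝ) * T11)) := by
  have hd1 : 1 ≤ d := by omega
  set L := Letters.perc d p with hL
  set Q : ℝ≥0∞ := ENNReal.ofReal T3 * W + ENNReal.ofReal ((p : ℝ) * (T2 + ((2 * d - 2 : ℕ) : ℝ) * T11)) with hQ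
  have hτ : ∀ ι : Fin d × Bool, L.tau (.ge 3) (stepVec ι) ≤ ENNReal.ofReal T3 := fun ι => by
    rw [hL, perc_tau_ge, tauGe_stepVec hd1]
    exact ENNReal.ofReal_le_ofReal h3
  have hS : (∑' x, L.B (.ge 3) (.eq 1) x 0) + ∑' x, ∑' y, L.T (.ge 1) (.eq 1) (.ge 1) y x 0 ≤ W := by
    rw [hL, perc_sausageRow_one_eq_vecPS]
    exact hW
  have hX : ∀ ι : Fin d × Bool, ∑' y, L.B (.ge 2) (.eq 1) y (stepVec ι) ≤
      ENNReal.ofReal ((p : ℝ) * (T2 + ((2 * d - 2 : ℕ) : ℝ) * T11)) := fun ι =>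
    perc_tsum_B_geTwo_eqOne_stepVec_le_ofReal p ι hab h2 h11
  have hι : ∀ ι : Fin d × Bool,
      L.tau (.ge 3) (stepVec ι) *
            ((∑' x, L.B (.ge 3) (.eq 1) x 0) + ∑' x, ∑' y, L.T (.ge 1) (.eq 1) (.ge 1) y x 0) +
          ∑' y, L.B (.ge 2) (.eq 1) y (stepVec ι) ≤ Q :=
    fun ι => add_le_add (mul_le_mul' (hτ ι) hS) (hX ι)
  have hd0 : (2 : ℝ≥0∞) * (d : ℝ≥0∞) ≠ 0 := by
    have : (d : ℝ≥0∞) ≠ 0 := by exact_mod_cast (show d ≠ 0 by omega)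
    exact mul_ne_zero two_ne_zero this
  have hdT : (2 : ℝ≥0∞) * (d : ℝ≥0∞) ≠ ∞ := ENNReal.mul_ne_top ENNReal.ofNat_ne_top (ENNReal.natCast_ne_top d)
  calc vecPiota L 1
      = invTwoD d * ∑ ι : Fin d × Bool,
          (L.tau (.ge 3) (stepVec ι) *
              ((∑' x, L.B (.ge 3) (.eq 1) x 0) + ∑' x, ∑' y, L.T (.ge 1) (.eq 1) (.ge 1) y x 0) +
            ∑' y, L.B (.ge 2) (.eq 1) y (stepVec ι)) := vecPiota_one _
    _ ≤ invTwoD d * ∑ _ι : Fin d × Bool, Q := by gcongr with ι _; exact hι ι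
    _ = invTwoD d * (2 * (d : ℝ≥0∞)) * Q := by
        rw [Finset.sum_const, Finset.card_univ, Fintype.card_prod, Fintype.card_fin, Fintype.card_bool, nsmul_eq_mul]
        push_cast
        ring
    _ = Q := by rw [invTwoD, ENNReal.inv_mul_cancel hd0 hdT, one_mul]

/-- **ENTRY INEQUALITY for `(P⃗^ι)_1`, one `ENNReal.ofReal`**: for a real majorant `0 ≤ W₁` of `(P⃗^S)_1`,
`τ_{3,p}(e₁) ≤ T3`, `τ_p(2e_a) ≤ T2`, `τ_p(e_a + e_b) ≤ T11` (`a ≠ b`, `d ≥ 2`):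
`vecPiota (Letters.perc d p) 1 ≤ ofReal (T3·W₁ + p·(T2 + (2d − 2)·T11))` — the shape consumed by the block-summation
majorant (`hPiota : ∀ b, vecPiota … b ≤ ofReal (w b)`).
[cite: FitznerVanDerHofstad2017, §5.1 "Elements of the bounds", `P⃗^ι` (arXiv:1506.07977v2 p. 50); App. B Table "definition of P^{ι,b}(x,y)" row b = 1 (p. 73); §5.4 closing paragraph (p. 56); §6.1 proof of Lemma 5.2, Case a = 1 (p. 60)]
[cite: FitznerVanDerHofstad2016NoBLE, Def. 2.5 (PTRF 169 (2017) p. 1058)] -/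
theorem perc_vecPiota_one_le_ofReal (hd : 2 ≤ d) (p : unitInterval) {T3 : ℝ} (h3 : tauGe d p 3 (unitSite1 d) ≤ T3)
    {W₁ : ℝ} (hW0 : 0 ≤ W₁) (hW : vecPS (Letters.perc d p) 1 ≤ ENNReal.ofReal W₁) {a b : Fin d} (hab : a ≠ b)
    {T2 T11 : ℝ} (h2 : tau d p 0 (Pi.single a 2) ≤ T2) (h11 : tau d p 0 (Pi.single a 1 + Pi.single b 1) ≤ T11) :
    vecPiota (Letters.perc d p) 1 ≤
      ENNReal.ofReal (T3 * W₁ + (p : ℝ) * (T2 + ((2 * d - 2 : ℕ) : ℝ) * T11)) := by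
  have hT3 : 0 ≤ T3 := (tauGe_nonneg p 3 _).trans h3
  have hT2 : 0 ≤ T2 := (Percolation.tau_nonneg p 0 _).trans h2
  have hT11 : 0 ≤ T11 := (Percolation.tau_nonneg p 0 _).trans h11
  have hX0 : 0 ≤ (p : ℝ) * (T2 + ((2 * d - 2 : ℕ) : ℝ) * T11) :=
    mul_nonneg p.2.1 (add_nonneg hT2 (mul_nonneg (Nat.cast_nonneg _) hT11))
  refine (perc_vecPiota_one_le hd p h3 hW hab h2 h11).trans_eq ?_
  rw [ENNReal.ofReal_add (mul_nonneg hT3 hW0) hX0, ENNReal.ofReal_mul hT3]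

end Literature.Probability.FitznerVanDerHofstad2017

end
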